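import Summits.QuantumFields.BalabanUV.Beta.CompositeCorrectorLocality
import Summits.QuantumFields.BalabanUV.Beta.CompositeCorrectorCovariance
import Summits.QuantumFields.BalabanUV.Beta.SymmetrisedAxialPotential

/-!
# `BalabanUV.Beta.SymCorrectorForms` — binder row D1, PART 23 re-ruling (F-g22-1 ∕ Q-g22-1, leaf-03 g28 N-g28-1 «CHART-TRANSPORT»), brick TT1:
# **THE ONE-STEP SYMMETRISED CORRECTORS AT FORM LEVEL** — the K-U3d corrector pair (`CompositeCorrectorForms.corrPhi ∕ corrPsi`, an2 g24) with the COMPOSITE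
# defect potential `ζ_m = compDefectAt` replaced by the (0.4)-SYMMETRISED one `ζ_S A := (d!)⁻¹ • SymLamAt ρ A n` (lattice dimension `d`, `S_d` symmetrisation):
# `Φ_S A := A − |box n|⁻¹ • dz (ext n (ζ_S A))`, `Ψ_S A := A + |box n|⁻¹ • dz (ext n (ζ_S A))` — MUTUALLY INVERSE (nilpotency of `ζ_S` on block-constant pure gauges),
# RE-LINEARISING the straight row to the symmetrised one (`contourSum n (Φ_S A) = contourSum n A − dz (ζ_S A) = (d!)⁻¹ • symLinAvgAt ρ A n`), SLICE-PRESERVING,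
# CURVATURE-FLAT, linear, coarse-translation covariant and block-local.

WHY.  The chart-(III′) literal's bordered operator `bhK n + Dsh n` (`SymShiftedSpread.bhKStepSh … 0`, an1's `DshAn1.Dsh`) has the SYMMETRISED linear averaging as its
border (`CombChartSpreadBlind.comp_bhK_add_Dsh_inr`: the multiplier row IS `((d+1)!)⁻¹·symLinAvgAt ρ_c`), and `SymmetrisedAxialPotential.symLinAvgAt_eq_contourSum_sub_dz`
puts it in the COARSE-EXACT DEFECT shape `contourSum n − 𝒬_sym = dz ∘ ζ_S` — the shape K-U3d consumes for the composite averaging.  With this file's letters the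
row's socket `RelInvCompositeSocket.relInv_composite_of_corrector'` applies to the symmetrised corrector pair (TT2), giving the (III′) interior comb kernel as
a CONJUGATE of the bm-chart one-shot kernel at the centre root: `GcombSh n 0 = Ψ̂_S ∘ coDressKBmAt ρ_c n (KInv n) ∘ Ψ̂_Sᵀ` (TT2's END; this file asserts none of it).

HONEST FRAMING (cell contract, verbatim): «discharging `BetaPertH` makes Bałaban's UV stability UNCONDITIONAL — a real constructive-QFT result; it
is NOT the continuum limit and NOT the Clay problem.»  HONEST DEPENDENCY (verbatim): «continuum YM on T⁴ ⇐ BetaPertH ∧ nine spine estimates (0/9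
proved); BetaPertH ⇐ (D1) ∧ (D4) ∧ CAP+tail; G-an2-4 gates asym, D1 and NE2/3/4.»
ABSOLUTE RULE (cell, verbatim): «No internally-minted statement may enter as a cited fact. Every hypothesis is either kernel-proved in this package or a
verbatim quotation of a PUBLISHED theorem with page reference. The manuscript(s) under audit are NOT citable for their own disputed steps — they are the
thing under adjudication; programme-internal (2001/route/tribunal) claims are never citable.»  NOTHING below is cited: no `[cite: …]`, no `Prop` fact.  Three DATA
definitions ([our object]: `zetaS`, `corrPhiS`, `corrPsiS`) and [folklore] finite-difference algebra over the cell's OWN typed objects BY NAME (`AffineAveraging.dz ∕ blockSum ∕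
contourSum ∕ curv`, `CompositeCorrectorForms.ext`, an1∕an2's `SymmetrisedAxialPotential.symAxial ∕ SymLamAt ∕ symLinAvgAt`).  It asserts nothing about Bałaban's
non-linear averages beyond their typed linearisations; discharges NOTHING of (K), of hW ∕ hR ∕ D1Tel ∕ D1Rep (0∕4), of D1 or of BetaPertH; NOT continuum, NOT Clay.

WHAT (`d` the lattice dimension, `n` the block side, `ρ` the root; COUNT units; all [folklore]):
§1 [our object] `zetaS ρ n A` (`= (d!)⁻¹ • SymLamAt ρ A n`); `SymLamAt_sub ∕ _smul`, `zetaS_sub ∕ _add ∕ _smul ∕ _zero`, **`contourSum_sub_dz_zetaS`**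
   (`contourSum n A − dz (zetaS ρ n A) = (d!)⁻¹ • symLinAvgAt ρ A n`).
§2 NILPOTENCY **`SymLamAt_dz_ext`**, **`zetaS_dz_ext`** (`ζ_S (dz (ext n g)) = 0`, in-block root).
§3 [our object] `corrPhiS`, `corrPsiS`; `zetaS_corrPhiS ∕ _corrPsiS`, **`corrPsiS_corrPhiS`**, **`corrPhiS_corrPsiS`**, **`contourSum_corrPhiS`**, `axialGaugeAt_corrPhiS_sub ∕ _corrPsiS_sub`,
   `curv_corrPhiS ∕ _corrPsiS`, `corrPhiS_apply ∕ corrPsiS_apply`, `corrPhiS_apply_of_blk_eq ∕ corrPsiS_apply_of_blk_eq`, linearity (`_add ∕ _smul ∕ _zero ∕ _sum_smul`).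
§4 COVARIANCE `SymLamAt_shift`, `zetaS_shift`, **`corrPhiS_shift`**, **`corrPsiS_shift`**.
§5 LOCALITY `inHull_psite`, `depOn_symAxial`, **`depOn_zetaS`**, **`depOn_corrPsiS`**, **`depOn_corrPhiS`** (read set = `CompositeCorrectorLocality.CorrReads n α x`).
Provenance: D1 formalisation swarm, unit `b2b-balaban-beta-d1-formalise-leaf-03` (gen 28), 2026-08-22; template an2 g24's `CompositeCorrectorForms ∕ Linear ∕ Covariance` and
leaf-06 g32's `CompositeCorrectorLocality` BY NAME; no existing file touched.
-/

namespace Summit.QuantumFields.BalabanUV.Beta.SymCorrectorForms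

open Finset
open scoped BigOperators Nat
open Literature.MathematicalPhysics.QuantumFieldTheory.Balaban1983to89.Beta
open AffineAveraging (Site Form0 Form1 box toSite unitVec dz curv blockSum contourSum contourSum_dz curv_dz)
open AveragingContours (blk blk_block grad axial axial_sum_grad grad_eq_dz shift)
open AveragingContoursRooted (treeGaugeAt AxialGaugeAt)
open AffineReproduction (dz_add dz_sub contourSum_sub)
open AxialProjector (blk_add_zsmul)
open Summit.QuantumFields.BalabanUV.Beta.KernelPermutation (psite psite_apply psite_symm_apply psite_add)
open Summit.QuantumFields.BalabanUV.Beta.ResolventPermutation (P1 P1_apply psite_unitVec)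
open Summit.QuantumFields.BalabanUV.Beta.AxialDressingRooted (InHull mem_axial_hull)
open Summit.QuantumFields.BalabanUV.Beta.SymmetrisedAxialPotential (axialPerm symAxial SymLamAt symLinAvgAt symAxial_grad symAxial_sub symAxial_add
  symLinAvgAt_eq_contourSum_sub_dz)
open Summit.QuantumFields.BalabanUV.Beta.CompositeCorrectorForms (ext ext_apply blockSum_ext axialGaugeAt_dz_ext smul_dz_ext contourSum_smul' curv_sub_smul_dz)
open Summit.QuantumFields.BalabanUV.Beta.CompositeCorrectorLinear (axial_sum_smul)
open Summit.QuantumFields.BalabanUV.Beta.CompositeCorrectorCovariance (dz_ext_eq_zero_of_blk_eq ext_shift)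
open Summit.QuantumFields.BalabanUV.Beta.CompositeCorrectorLocality (DepOn DepOn.mono DepOn.add DepOn.sub DepOn.mul_left depOn_eval depOn_sum depOn_const
  blk_eq_of_inHull InBlockBond CorrReads)

noncomputable section

variable {d : ℕ}

/-! ## §1 The symmetrised defect potential `ζ_S` and the coarse-exact defect `contourSum − 𝒬_sym = dz ∘ ζ_S` -/

/-- [our object] **THE ONE-STEP SYMMETRISED DEFECT POTENTIAL** `ζ_S A := (d!)⁻¹ • SymLamAt ρ A n` (a coarse 0-form; an1's `lam04`-potential superposed over the field). -/
def zetaS (ρ : Site d) (n : ℕ) (A : Form1 d ℝ) : Form0 d ℝ := fun Y => ((d ! : ℕ) : ℝ)⁻¹ * SymLamAt ρ A n Y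

/-- [folklore] `zetaS` unfolds. -/
theorem zetaS_apply (ρ : Site d) (n : ℕ) (A : Form1 d ℝ) (Y : Site d) : zetaS ρ n A Y = ((d ! : ℕ) : ℝ)⁻¹ * SymLamAt ρ A n Y := rfl

/-- [folklore] `axialPerm` is ℝ-homogeneous in the field. -/
theorem axialPerm_smul (σ : Equiv.Perm (Fin d)) (c : ℝ) (A : Form1 d ℝ) (y x : Site d) : axialPerm σ (c • A) y x = c * axialPerm σ A y x := by
  unfold axialPerm
  rw [show P1 σ (c • A) = c • P1 σ A from rfl, axial_sum_smul]

/-- [folklore] `symAxial` is ℝ-homogeneous in the field. -/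
theorem symAxial_smul (c : ℝ) (A : Form1 d ℝ) (y x : Site d) : symAxial (c • A) y x = c * symAxial A y x := by
  simp only [symAxial, axialPerm_smul, Finset.mul_sum]

/-- [folklore] `SymLamAt` is subtractive in the field. -/
theorem SymLamAt_sub (ρ : Site d) (A B : Form1 d ℝ) (n : ℕ) : SymLamAt ρ (A - B) n = SymLamAt ρ A n - SymLamAt ρ B n := by
  funext Y
  simp only [SymLamAt, Pi.sub_apply, symAxial_sub, Finset.sum_sub_distrib]

/-- [folklore] `SymLamAt` is ℝ-homogeneous in the field. -/
theorem SymLamAt_smul (ρ : Site d) (c : ℝ) (A : Form1 d ℝ) (n : ℕ) : SymLamAt ρ (c • A) n = c • SymLamAt ρ A n := by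
  funext Y
  simp only [SymLamAt, Pi.smul_apply, smul_eq_mul, symAxial_smul, Finset.mul_sum]

/-- [folklore] `SymLamAt` of the zero field vanishes. -/
theorem SymLamAt_zero (ρ : Site d) (n : ℕ) : SymLamAt ρ (0 : Form1 d ℝ) n = 0 := by
  have h := SymLamAt_smul ρ 0 (0 : Form1 d ℝ) n
  rwa [zero_smul, zero_smul] at h

/-- [folklore] `ζ_S` is subtractive. -/
theorem zetaS_sub (ρ : Site d) (n : ℕ) (A B : Form1 d ℝ) : zetaS ρ n (A - B) = zetaS ρ n A - zetaS ρ n B := by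
  funext Y; simp only [zetaS_apply, Pi.sub_apply, SymLamAt_sub, mul_sub]

/-- [folklore] `ζ_S` is ℝ-homogeneous. -/
theorem zetaS_smul (ρ : Site d) (n : ℕ) (c : ℝ) (A : Form1 d ℝ) : zetaS ρ n (c • A) = c • zetaS ρ n A := by
  funext Y; simp only [zetaS_apply, Pi.smul_apply, SymLamAt_smul, smul_eq_mul]; ring

/-- [folklore] `ζ_S 0 = 0`. -/
theorem zetaS_zero (ρ : Site d) (n : ℕ) : zetaS ρ n (0 : Form1 d ℝ) = 0 := by
  have h := zetaS_smul ρ n 0 (0 : Form1 d ℝ)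
  rwa [zero_smul, zero_smul] at h

/-- [folklore] `ζ_S` is additive. -/
theorem zetaS_add (ρ : Site d) (n : ℕ) (A B : Form1 d ℝ) : zetaS ρ n (A + B) = zetaS ρ n A + zetaS ρ n B := by
  have h := zetaS_sub ρ n (A + B) B
  rw [add_sub_cancel_right] at h
  rw [← sub_eq_iff_eq_add.mp h.symm]

/-- [folklore] **THE COARSE-EXACT DEFECT OF THE SYMMETRISED LINEAR AVERAGING**: `contourSum n A − dz (ζ_S A) = (d!)⁻¹ • symLinAvgAt ρ A n` — i.e.
`contourSum n − 𝒬_sym = dz ∘ ζ_S` with `𝒬_sym := (d!)⁻¹ • symLinAvgAt ρ · n` (an1∕an2's `symLinAvgAt_eq_contourSum_sub_dz`, divided by `d!`). -/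
theorem contourSum_sub_dz_zetaS (ρ : Site d) (n : ℕ) (A : Form1 d ℝ) :
    contourSum n A - dz (zetaS ρ n A) = fun μ y => ((d ! : ℕ) : ℝ)⁻¹ * symLinAvgAt ρ A n μ y := by
  have hd : ((d ! : ℕ) : ℝ) ≠ 0 := by exact_mod_cast (Nat.factorial_pos d).ne'
  funext μ y
  rw [Pi.sub_apply, Pi.sub_apply, symLinAvgAt_eq_contourSum_sub_dz]
  simp only [dz, zetaS_apply]
  rw [mul_sub, mul_sub, ← mul_assoc, inv_mul_cancel₀ hd, one_mul]

/-! ## §2 Nilpotency: `ζ_S` kills block-constant pure gauges -/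

/-- [folklore] **THE SYMMETRISED BLOCK POTENTIAL OF AN EXACT BLOCK-CONSTANT FORM VANISHES** (in-block root): every symmetrised contour from the block root to a
block site integrates `dz (ext n g)` to `g Y − g Y = 0` (`symAxial_grad`, `blk_block`). -/
theorem SymLamAt_dz_ext {n : ℕ} {r : Fin d → ℕ} (hr : r ∈ box d n) (g : Form0 d ℝ) : SymLamAt (toSite r) (dz (ext n g)) n = 0 := by
  funext Y
  rw [SymLamAt, Pi.zero_apply]
  refine Finset.sum_eq_zero fun b hb => ?_
  rw [← grad_eq_dz, symAxial_grad, ext_apply, ext_apply, blk_block Y hb, blk_block Y hr, sub_self, mul_zero]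

/-- [folklore] **NILPOTENCY**: `ζ_S (dz (ext n g)) = 0` (in-block root). -/
theorem zetaS_dz_ext {n : ℕ} {r : Fin d → ℕ} (hr : r ∈ box d n) (g : Form0 d ℝ) : zetaS (toSite r) n (dz (ext n g)) = 0 := by
  funext Y
  rw [zetaS_apply, SymLamAt_dz_ext hr, Pi.zero_apply, mul_zero]

/-! ## §3 The symmetrised correctors -/

/-- [our object] **THE SYMMETRISED CORRECTOR ON THE BORDER SIDE**: `Φ_S A := A − |box n|⁻¹ • dz (ext n (ζ_S A))`. -/
def corrPhiS (ρ : Site d) (n : ℕ) (A : Form1 d ℝ) : Form1 d ℝ :=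
  A - ((box d n).card : ℝ)⁻¹ • dz (ext n (zetaS ρ n A))

/-- [our object] **ITS INVERSE (the dressing-side corrector)**: `Ψ_S A := A + |box n|⁻¹ • dz (ext n (ζ_S A))`. -/
def corrPsiS (ρ : Site d) (n : ℕ) (A : Form1 d ℝ) : Form1 d ℝ :=
  A + ((box d n).card : ℝ)⁻¹ • dz (ext n (zetaS ρ n A))

/-- [folklore] `Φ_S` componentwise. -/
theorem corrPhiS_apply (ρ : Site d) (n : ℕ) (A : Form1 d ℝ) (α : Fin d) (x : Site d) :
    corrPhiS ρ n A α x = A α x - ((box d n).card : ℝ)⁻¹ * (zetaS ρ n A (blk n (x + unitVec α)) - zetaS ρ n A (blk n x)) := by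
  simp only [corrPhiS, Pi.sub_apply, Pi.smul_apply, smul_eq_mul, dz, ext_apply]

/-- [folklore] `Ψ_S` componentwise. -/
theorem corrPsiS_apply (ρ : Site d) (n : ℕ) (A : Form1 d ℝ) (α : Fin d) (x : Site d) :
    corrPsiS ρ n A α x = A α x + ((box d n).card : ℝ)⁻¹ * (zetaS ρ n A (blk n (x + unitVec α)) - zetaS ρ n A (blk n x)) := by
  simp only [corrPsiS, Pi.add_apply, Pi.smul_apply, smul_eq_mul, dz, ext_apply]

/-- [folklore] **`Φ_S` DOES NOT TOUCH INTRA-BLOCK COORDINATES**: `blk n (x + e_α) = blk n x ⟹ (Φ_S A) α x = A α x`. -/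
theorem corrPhiS_apply_of_blk_eq (ρ : Site d) (n : ℕ) (A : Form1 d ℝ) {α : Fin d} {x : Site d} (hx : blk n (x + unitVec α) = blk n x) :
    corrPhiS ρ n A α x = A α x := by
  rw [corrPhiS, Pi.sub_apply, Pi.sub_apply, Pi.smul_apply, Pi.smul_apply, dz_ext_eq_zero_of_blk_eq _ hx, smul_zero, sub_zero]

/-- [folklore] **`Ψ_S` DOES NOT TOUCH INTRA-BLOCK COORDINATES.** -/
theorem corrPsiS_apply_of_blk_eq (ρ : Site d) (n : ℕ) (A : Form1 d ℝ) {α : Fin d} {x : Site d} (hx : blk n (x + unitVec α) = blk n x) :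
    corrPsiS ρ n A α x = A α x := by
  rw [corrPsiS, Pi.add_apply, Pi.add_apply, Pi.smul_apply, Pi.smul_apply, dz_ext_eq_zero_of_blk_eq _ hx, smul_zero, add_zero]

section Root
variable {n : ℕ} {r : Fin d → ℕ}

/-- [folklore] The defect potential does not see the correction term: `ζ_S (c • dz (ext n h)) = 0` (in-block root). -/
theorem zetaS_corr_term (hr : r ∈ box d n) (c : ℝ) (h : Form0 d ℝ) : zetaS (toSite r) n (c • dz (ext n h)) = 0 := by
  rw [smul_dz_ext, zetaS_dz_ext hr]

/-- [folklore] `ζ_S (Φ_S A) = ζ_S A`. -/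
theorem zetaS_corrPhiS (hr : r ∈ box d n) (A : Form1 d ℝ) : zetaS (toSite r) n (corrPhiS (toSite r) n A) = zetaS (toSite r) n A := by
  rw [corrPhiS, zetaS_sub, zetaS_corr_term hr, sub_zero]

/-- [folklore] `ζ_S (Ψ_S A) = ζ_S A`. -/
theorem zetaS_corrPsiS (hr : r ∈ box d n) (A : Form1 d ℝ) : zetaS (toSite r) n (corrPsiS (toSite r) n A) = zetaS (toSite r) n A := by
  have h : corrPsiS (toSite r) n A = A - (-(((box d n).card : ℝ)⁻¹) • dz (ext n (zetaS (toSite r) n A))) := by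
    rw [corrPsiS, neg_smul, sub_neg_eq_add]
  rw [h, zetaS_sub, zetaS_corr_term hr, sub_zero]

/-- [folklore] **THE SYMMETRISED CORRECTORS ARE MUTUALLY INVERSE (I)**: `Ψ_S (Φ_S A) = A` (in-block root). -/
theorem corrPsiS_corrPhiS (hr : r ∈ box d n) (A : Form1 d ℝ) : corrPsiS (toSite r) n (corrPhiS (toSite r) n A) = A := by
  rw [corrPsiS, zetaS_corrPhiS hr, corrPhiS, sub_add_cancel]

/-- [folklore] **THE SYMMETRISED CORRECTORS ARE MUTUALLY INVERSE (II)**: `Φ_S (Ψ_S A) = A` (in-block root). -/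
theorem corrPhiS_corrPsiS (hr : r ∈ box d n) (A : Form1 d ℝ) : corrPhiS (toSite r) n (corrPsiS (toSite r) n A) = A := by
  rw [corrPhiS, zetaS_corrPsiS hr, corrPsiS, add_sub_cancel_right]

end Root

/-- [folklore] **RE-LINEARISATION OF THE BORDER**: `contourSum n (Φ_S A) = contourSum n A − dz (ζ_S A)` (`0 < n`) — hence (`contourSum_sub_dz_zetaS`) the straight row of the
corrected field IS the symmetrised linearised averaging `(d!)⁻¹ • symLinAvgAt ρ A n` of the field. -/
theorem contourSum_corrPhiS (ρ : Site d) {n : ℕ} (hn : 0 < n) (A : Form1 d ℝ) :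
    contourSum n (corrPhiS ρ n A) = contourSum n A - dz (zetaS ρ n A) := by
  have hcard : ((box d n).card : ℝ) ≠ 0 := by
    have : 0 < (box d n).card := by
      rw [Finset.card_pos]
      exact ⟨fun _ => 0, Fintype.mem_piFinset.2 fun _ => Finset.mem_range.2 hn⟩
    exact_mod_cast this.ne'
  rw [corrPhiS, contourSum_sub, contourSum_smul', contourSum_dz, blockSum_ext]
  have e : ((box d n).card : ℝ)⁻¹ • dz (((box d n).card : ℝ) • zetaS ρ n A) = dz (zetaS ρ n A) := by
    funext κ y; simp only [Pi.smul_apply, dz, smul_eq_mul]; field_simp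
  rw [e]

/-- [folklore] The same in the `symLinAvgAt` currency: `contourSum n (Φ_S A) μ y = (d!)⁻¹ · symLinAvgAt ρ A n μ y`. -/
theorem contourSum_corrPhiS_eq_symLinAvgAt (ρ : Site d) {n : ℕ} (hn : 0 < n) (A : Form1 d ℝ) (μ : Fin d) (y : Site d) :
    contourSum n (corrPhiS ρ n A) μ y = ((d ! : ℕ) : ℝ)⁻¹ * symLinAvgAt ρ A n μ y := by
  rw [contourSum_corrPhiS ρ hn, contourSum_sub_dz_zetaS]

/-- [folklore] **SLICE PRESERVATION (Φ_S)**: `Φ_S A − A` is rooted-axial at scale `n` for ANY in-block root `s` (independently of `ρ`). -/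
theorem axialGaugeAt_corrPhiS_sub (ρ : Site d) (n : ℕ) {s : Fin d → ℕ} (hs : s ∈ box d n) (A : Form1 d ℝ) :
    AxialGaugeAt (toSite s) (corrPhiS ρ n A - A) n := by
  intro y b hb
  have h := axialGaugeAt_dz_ext hs (-(((box d n).card : ℝ)⁻¹) • zetaS ρ n A) y b hb
  rw [← smul_dz_ext] at h
  have e : corrPhiS ρ n A - A = (-(((box d n).card : ℝ)⁻¹)) • dz (ext n (zetaS ρ n A)) := by
    rw [corrPhiS, neg_smul]; abel
  rw [e]; exact h

/-- [folklore] **SLICE PRESERVATION (Ψ_S)**: `Ψ_S A − A` is rooted-axial at scale `n` for any in-block root. -/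
theorem axialGaugeAt_corrPsiS_sub (ρ : Site d) (n : ℕ) {s : Fin d → ℕ} (hs : s ∈ box d n) (A : Form1 d ℝ) :
    AxialGaugeAt (toSite s) (corrPsiS ρ n A - A) n := by
  intro y b hb
  have h := axialGaugeAt_dz_ext hs ((((box d n).card : ℝ)⁻¹) • zetaS ρ n A) y b hb
  rw [← smul_dz_ext] at h
  have e : corrPsiS ρ n A - A = (((box d n).card : ℝ)⁻¹) • dz (ext n (zetaS ρ n A)) := by
    rw [corrPsiS]; abel
  rw [e]; exact h

/-- [folklore] **FLATNESS (Φ_S)**: `curv (Φ_S A) = curv A` — the fine Wilson Hessian `curvAdj ∘ curv` does not see the corrector. -/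
theorem curv_corrPhiS (ρ : Site d) (n : ℕ) (A : Form1 d ℝ) : curv (corrPhiS ρ n A) = curv A := by
  rw [corrPhiS]; exact curv_sub_smul_dz A _ _

/-- [folklore] **FLATNESS (Ψ_S)**: `curv (Ψ_S A) = curv A`. -/
theorem curv_corrPsiS (ρ : Site d) (n : ℕ) (A : Form1 d ℝ) : curv (corrPsiS ρ n A) = curv A := by
  have h : corrPsiS ρ n A = A - (-(((box d n).card : ℝ)⁻¹)) • dz (ext n (zetaS ρ n A)) := by
    rw [corrPsiS, neg_smul, sub_neg_eq_add]
  rw [h]; exact curv_sub_smul_dz A _ _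

/-! ### Linearity -/

/-- [folklore] `Ψ_S` is additive. -/
theorem corrPsiS_add (ρ : Site d) (n : ℕ) (A B : Form1 d ℝ) : corrPsiS ρ n (A + B) = corrPsiS ρ n A + corrPsiS ρ n B := by
  funext α x
  simp only [corrPsiS_apply, Pi.add_apply, zetaS_add]
  ring

/-- [folklore] `Ψ_S` is homogeneous. -/
theorem corrPsiS_smul (ρ : Site d) (n : ℕ) (c : ℝ) (A : Form1 d ℝ) : corrPsiS ρ n (c • A) = c • corrPsiS ρ n A := by
  funext α x
  simp only [corrPsiS_apply, Pi.smul_apply, smul_eq_mul, zetaS_smul]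
  ring

/-- [folklore] `Ψ_S 0 = 0`. -/
theorem corrPsiS_zero (ρ : Site d) (n : ℕ) : corrPsiS ρ n (0 : Form1 d ℝ) = 0 := by
  have h := corrPsiS_smul ρ n 0 (0 : Form1 d ℝ)
  rwa [zero_smul, zero_smul] at h

/-- [folklore] `Ψ_S` of a finite linear combination. -/
theorem corrPsiS_sum_smul {ι : Type*} (ρ : Site d) (n : ℕ) (s : Finset ι) (c : ι → ℝ) (B : ι → Form1 d ℝ) :
    corrPsiS ρ n (∑ i ∈ s, c i • B i) = ∑ i ∈ s, c i • corrPsiS ρ n (B i) := by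
  classical
  induction s using Finset.induction_on with
  | empty => simp [corrPsiS_zero]
  | insert a s ha ih => rw [Finset.sum_insert ha, Finset.sum_insert ha, corrPsiS_add, corrPsiS_smul, ih]

/-- [folklore] `Φ_S` is additive. -/
theorem corrPhiS_add (ρ : Site d) (n : ℕ) (A B : Form1 d ℝ) : corrPhiS ρ n (A + B) = corrPhiS ρ n A + corrPhiS ρ n B := by
  funext α x
  simp only [corrPhiS_apply, Pi.add_apply, zetaS_add]
  ring

/-- [folklore] `Φ_S` is homogeneous. -/
theorem corrPhiS_smul (ρ : Site d) (n : ℕ) (c : ℝ) (A : Form1 d ℝ) : corrPhiS ρ n (c • A) = c • corrPhiS ρ n A := by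
  funext α x
  simp only [corrPhiS_apply, Pi.smul_apply, smul_eq_mul, zetaS_smul]
  ring

/-- [folklore] `Φ_S 0 = 0`. -/
theorem corrPhiS_zero (ρ : Site d) (n : ℕ) : corrPhiS ρ n (0 : Form1 d ℝ) = 0 := by
  have h := corrPhiS_smul ρ n 0 (0 : Form1 d ℝ)
  rwa [zero_smul, zero_smul] at h

/-- [folklore] `Φ_S` of a finite linear combination. -/
theorem corrPhiS_sum_smul {ι : Type*} (ρ : Site d) (n : ℕ) (s : Finset ι) (c : ι → ℝ) (B : ι → Form1 d ℝ) :
    corrPhiS ρ n (∑ i ∈ s, c i • B i) = ∑ i ∈ s, c i • corrPhiS ρ n (B i) := by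
  classical
  induction s using Finset.induction_on with
  | empty => simp [corrPhiS_zero]
  | insert a s ha ih => rw [Finset.sum_insert ha, Finset.sum_insert ha, corrPhiS_add, corrPhiS_smul, ih]

/-! ## §4 Coarse translation covariance -/

/-- [folklore] **COVARIANCE OF THE SYMMETRISED POTENTIAL**: `SymLamAt ρ (shift (n•v) A) n Y = SymLamAt ρ A n (Y + v)` (`symAxial_add`). -/
theorem SymLamAt_shift (ρ : Site d) (A : Form1 d ℝ) (n : ℕ) (v Y : Site d) :
    SymLamAt ρ (shift ((n : ℤ) • v) A) n Y = SymLamAt ρ A n (Y + v) := by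
  simp only [SymLamAt]
  refine Finset.sum_congr rfl fun b _ => ?_
  rw [← symAxial_add]
  congr 1
  · rw [smul_add]; abel
  · rw [smul_add]; abel

/-- [folklore] Covariance of `ζ_S`: `ζ_S (shift (n•v) A) = (ζ_S A) ∘ (· + v)`. -/
theorem zetaS_shift (ρ : Site d) (n : ℕ) (A : Form1 d ℝ) (v : Site d) :
    zetaS ρ n (shift ((n : ℤ) • v) A) = fun Y => zetaS ρ n A (Y + v) := by
  funext Y; rw [zetaS_apply, zetaS_apply, SymLamAt_shift]

/-- [folklore] **COARSE TRANSLATION COVARIANCE OF `Φ_S`**: `Φ_S (shift (n•v) A) = shift (n•v) (Φ_S A)` (`1 ≤ n`). -/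
theorem corrPhiS_shift (ρ : Site d) {n : ℕ} (hn : 1 ≤ n) (A : Form1 d ℝ) (v : Site d) :
    corrPhiS ρ n (shift ((n : ℤ) • v) A) = shift ((n : ℤ) • v) (corrPhiS ρ n A) := by
  have hz := zetaS_shift ρ n A v
  funext α x
  simp only [corrPhiS, Pi.sub_apply, Pi.smul_apply, shift, dz]
  rw [hz]
  have e1 : ext n (fun Y => zetaS ρ n A (Y + v)) (x + unitVec α) = ext n (zetaS ρ n A) (x + ((n : ℤ) • v) + unitVec α) := by
    rw [add_right_comm, ext_shift hn]
  have e2 : ext n (fun Y => zetaS ρ n A (Y + v)) x = ext n (zetaS ρ n A) (x + ((n : ℤ) • v)) := by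
    rw [ext_shift hn]
  rw [e1, e2]

/-- [folklore] **COARSE TRANSLATION COVARIANCE OF `Ψ_S`.** -/
theorem corrPsiS_shift (ρ : Site d) {n : ℕ} (hn : 1 ≤ n) (A : Form1 d ℝ) (v : Site d) :
    corrPsiS ρ n (shift ((n : ℤ) • v) A) = shift ((n : ℤ) • v) (corrPsiS ρ n A) := by
  have hz := zetaS_shift ρ n A v
  funext α x
  simp only [corrPsiS, Pi.add_apply, Pi.smul_apply, shift, dz]
  rw [hz]
  have e1 : ext n (fun Y => zetaS ρ n A (Y + v)) (x + unitVec α) = ext n (zetaS ρ n A) (x + ((n : ℤ) • v) + unitVec α) := by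
    rw [add_right_comm, ext_shift hn]
  have e2 : ext n (fun Y => zetaS ρ n A (Y + v)) x = ext n (zetaS ρ n A) (x + ((n : ℤ) • v)) := by
    rw [ext_shift hn]
  rw [e1, e2]

/-! ## §5 Locality: the correctors read finitely many bonds -/

/-- [folklore] The coordinatewise hull is transported by a coordinate permutation: `InHull (σ⁻¹•y) (σ⁻¹•x) z ⟹ InHull y x (σ•z)`. -/
theorem inHull_psite (σ : Equiv.Perm (Fin d)) {y x z : Site d} (h : InHull ((psite σ).symm y) ((psite σ).symm x) z) : InHull y x (psite σ z) := by
  intro j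
  have hj := h (σ.symm j)
  simp only [psite_symm_apply, Equiv.apply_symm_apply] at hj
  simpa only [psite_apply] using hj

/-- [folklore] **THE SYMMETRISED CONTOUR INTEGRAL FROM THE BLOCK ROOT TO A BLOCK SITE READS ONLY BONDS WITH BOTH ENDPOINTS IN THE BLOCK** (in-block root offset `r`;
every permuted comb stays in the coordinatewise hull of its endpoints — `mem_axial_hull`, `blk_eq_of_inHull`). -/
theorem depOn_symAxial {n : ℕ} (hn : 1 ≤ n) {r : Fin d → ℕ} (hr : r ∈ box d n) (Y : Site d) {b : Fin d → ℕ} (hb : b ∈ box d n) :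
    DepOn (InBlockBond n Y) fun A => symAxial A ((n : ℤ) • Y + toSite r) ((n : ℤ) • Y + toSite b) := by
  refine ⟨fun A B hAB => ?_⟩
  show symAxial A _ _ = symAxial B _ _
  rw [← sub_eq_zero, ← symAxial_sub]
  simp only [symAxial]
  refine Finset.sum_eq_zero fun σ _ => ?_
  unfold axialPerm
  refine List.sum_eq_zero fun a ha => ?_
  obtain ⟨κ, z, e, hz, hz'⟩ := mem_axial_hull ha
  have hx : blk n ((n : ℤ) • Y + toSite b) = Y := blk_block Y hb
  have h0 : P1 σ (A - B) κ z = 0 := by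
    rw [P1_apply, Pi.sub_apply, Pi.sub_apply, sub_eq_zero]
    refine hAB (σ κ) (psite σ z) ⟨blk_eq_of_inHull hn hr hx (inHull_psite σ hz), ?_⟩
    rw [← psite_unitVec, ← psite_add]
    exact blk_eq_of_inHull hn hr hx (inHull_psite σ hz')
  rcases e with e | e
  · rw [e, h0]
  · rw [e, h0, neg_zero]

/-- [folklore] **`ζ_S A (Y)` READS ONLY THE BONDS WITH BOTH ENDPOINTS IN THE `n`-BLOCK `Y`** (in-block root offset). -/
theorem depOn_zetaS {n : ℕ} (hn : 1 ≤ n) {r : Fin d → ℕ} (hr : r ∈ box d n) (Y : Site d) :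
    DepOn (InBlockBond n Y) fun A => zetaS (toSite r) n A Y := by
  simp only [zetaS_apply, SymLamAt]
  exact DepOn.mul_left _ (depOn_sum _ fun b hb => depOn_symAxial hn hr Y hb)

/-- [folklore] **`(Ψ_S A)_α(x)` READS ONLY THE BONDS OF `CorrReads n α x`** (in-block root offset). -/
theorem depOn_corrPsiS {n : ℕ} (hn : 1 ≤ n) {r : Fin d → ℕ} (hr : r ∈ box d n) (α : Fin d) (x : Site d) :
    DepOn (CorrReads n α x) fun A => corrPsiS (toSite r) n A α x := by
  simp only [corrPsiS_apply]
  refine DepOn.add ((depOn_eval α x).mono fun p hp => Or.inl hp) (DepOn.mul_left _ (DepOn.sub ?_ ?_))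
  · exact (depOn_zetaS hn hr _).mono fun p hp => Or.inr (Or.inr hp)
  · exact (depOn_zetaS hn hr _).mono fun p hp => Or.inr (Or.inl hp)

/-- [folklore] **`(Φ_S A)_α(x)` READS ONLY THE BONDS OF `CorrReads n α x`** (in-block root offset). -/
theorem depOn_corrPhiS {n : ℕ} (hn : 1 ≤ n) {r : Fin d → ℕ} (hr : r ∈ box d n) (α : Fin d) (x : Site d) :
    DepOn (CorrReads n α x) fun A => corrPhiS (toSite r) n A α x := by
  simp only [corrPhiS_apply]
  refine DepOn.sub ((depOn_eval α x).mono fun p hp => Or.inl hp) (DepOn.mul_left _ (DepOn.sub ?_ ?_))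
  · exact (depOn_zetaS hn hr _).mono fun p hp => Or.inr (Or.inr hp)
  · exact (depOn_zetaS hn hr _).mono fun p hp => Or.inr (Or.inl hp)

end

end Summit.QuantumFields.BalabanUV.Beta.SymCorrectorForms
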